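import Literature.MathematicalPhysics.QuantumLattice.SpinChainsAkltFrustrationFreeProofs
import Literature.MathematicalPhysics.QuantumLattice.MatrixProductStatesAkltOpenKernelProofs
import Literature.MathematicalPhysics.QuantumLattice.MatrixProductStatesGroundStateProofs
import HarnessLib

/-!
# Discharged fact: the open AKLT chain has an exactly fourfold degenerate ground state

Trunk **T-QLATTICE**. Theorem-only sibling proof file of
`Literature/MathematicalPhysics/QuantumLattice/SpinChains.lean` (next to
`SpinChainsAkltFrustrationFreeProofs.lean`, `SpinChainsAkltOpenChainProofs.lean`). It discharges the
named fact (`def X : Prop`, D-0014)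

* `Literature.MathematicalPhysics.QuantumLattice.aklt_open_degeneracy` — for `2 ≤ L` the open
  AKLT chain `H = Σ_{i=0}^{L-2} (𝐒_i · 𝐒_{i+1} + ⅓ (𝐒_i · 𝐒_{i+1})²)` on `L` spin-`1` sites has
  ground energy `-2(L-1)/3` and an exactly four-dimensional ground space
  (`aklt_open_degeneracy_holds`);

no statement or definition is introduced or changed.

## Source

I. Affleck, T. Kennedy, E. H. Lieb, H. Tasaki, *Valence bond ground states in isotropic quantum
antiferromagnets*, Comm. Math. Phys. **115** (1988) 477–528 (held: `paper:doi-10-1007-bf01218021`):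
§2.1, eqs. (2.1)–(2.2) (`H = Σ_i P₂(𝐒_i + 𝐒_{i+1})`, `P₂ = ½ 𝐒_i·𝐒_{i+1} + ⅙ (𝐒_i·𝐒_{i+1})² + ⅓`,
the open chain `{1, …, L}`), the four VBS states `Ω_{αβ}` (eq. (2.7)) with `H_i Ω_{αβ} = 0`, and
**Remark 1** (p. 484): "For a finite chain with open boundary conditions we have found four ground
states. … the four ground states are nonzero and linearly independent. In Lemma 2.8 of Sect. 2.4 we
will prove that they are the only finite volume ground states. Hence the open chain has a fourfold
degenerate ground state"; §2.4 **Lemma 2.8** (finite volume lemma, pp. 493–495). H. Tasaki,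
*Physics and Mathematics of Quantum Many-Body Systems* (2020), §7.1.2 (the cite carried by the
fact).

## Proof

Write `T_x = P₂(x, x+1)` for the bond-spin-`2` projection placed on the block `{x, x+1}` of `Fin L`
and `Q = Σ_{x+2 ≤ L} T_x = parentHamiltonianOpen L 2 akltTensor` (`parentLocalTerm_two_akltTensor`:
the two-site parent term of the AKLT tensor is `P₂`).
1. `akltOpenChain_eq_parentHamiltonianOpen`: since `h_{x,x+1} = 𝐒·𝐒 + ⅓(𝐒·𝐒)² = 2 P₂ - ⅔`
   (transport of `P₂ = ⅙ D² + ½ D + ⅓` to the block, `localOp_chainBlock_parentLocalTerm_akltTensor`,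
   via `LocalOpTransport`) and there are `L - 1` bonds, `H = 2Q - (2(L-1)/3) 𝟙`.
2. `Q ≥ 0` (`parentHamiltonianOpen_posSemidef`), and `Q ψ = 0 ↔ ψ = ψ_B` for some boundary matrix
   `B` (`parentHamiltonianOpen_akltTensor_mulVec_eq_zero_iff`): `⇐` is
   `parentHamiltonianOpen_mulVec_mpsWithBoundary_eq_zero_holds`; for `⇒`, a sum of positive
   matrices kills `ψ` only if each `T_x` does (`mulVec_eq_zero_of_sum_posSemidef`), `T_x ψ = 0`
   says that every two-site slice of `ψ` is killed by `P₂`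
   (`localOp_chainBlock_submatrix_mulVec_eq_zero_iff`), and then AKLT's Lemma 2.8
   (`exists_mpsWithBoundary_akltTensor_of_parentLocalTerm_mulVec_eq_zero`) gives `ψ = ψ_B`.
3. `B ↦ ψ_B` is injective for `L ≥ 2` (`eq_of_trace_mul_wordProduct_eq` with
   `isInjectiveMPS_akltTensor_two`), so `ψ_𝟙 ≠ 0` is an eigenvector with `H ψ_𝟙 = -(2(L-1)/3) ψ_𝟙`
   and `H + 2(L-1)/3 = 2Q ≥ 0`, whence `E₀ = -2(L-1)/3` (`groundEnergy_eq_of_posSemidef_sub`), the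
   ground space `ker (H - E₀) = ker Q` is the range of the injective linear map `B ↦ ψ_B` on
   `M₂(ℂ)`, and its dimension is `4` — AKLT's Remark 1.

## References

* I. Affleck, T. Kennedy, E. H. Lieb, H. Tasaki, Comm. Math. Phys. **115** (1988) 477–528,
  doi:10.1007/bf01218021, §2.1 eqs. (2.1), (2.2), (2.7), Remark 1 (p. 484); §2.4 Lemma 2.8
  (pp. 493–495). [AffleckEtAl1988]
* H. Tasaki, *Physics and Mathematics of Quantum Many-Body Systems*, Springer (2020),
  doi:10.1007/978-3-030-41265-4, §7.1.2. [Tasaki2020]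
* M. Fannes, B. Nachtergaele, R. F. Werner, Comm. Math. Phys. **144** (1992) 443–490, §5
  (Def. 5.4, eq. (5.11), Lemma 5.5), §7. [FannesNachtergaeleWernerCMP1992]
-/

noncomputable section

open Matrix Complex
open scoped ComplexOrder MatrixOrder

namespace Literature.MathematicalPhysics.QuantumLattice

section QLattice

/-! ### Blocks `{x, x+1}` of the open chain -/

/-- The site labelling `i ↦ x + i` of the block `{x, …, x+ℓ-1}` of the open chain (`x + ℓ ≤ L`)
is a bijection `Fin ℓ → chainBlock L ℓ x h`. [folklore] -/
theorem chainBlockSite_bijective (L ℓ : ℕ) (x : Fin L) (h : (x : ℕ) + ℓ ≤ L) :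
    Function.Bijective (chainBlockSite L ℓ x h) := by
  constructor
  · intro i j hij
    have hv := congrArg (fun y : chainBlock L ℓ x h => ((y : Fin L) : ℕ)) hij
    simp only [coe_chainBlockSite] at hv
    exact Fin.ext (by omega)
  · rintro ⟨y, hy⟩
    simp only [chainBlock, Finset.mem_image, Finset.mem_univ, true_and] at hy
    obtain ⟨i, rfl⟩ := hy
    exact ⟨i, rfl⟩

/-- **The transported exchange operator (open chain).** Placing the two-site exchange operator
`𝐒₀ · 𝐒₁` on the block `{x, x+1}` of the open chain `Fin L` gives `𝐒_x · 𝐒_{x+1}` (the placement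
is a unital algebra homomorphism sending `onSite i a` to `onSite (x+i) a`, `LocalOpTransport`).
Tasaki (2020) §2.4; Bratteli–Robinson II §6.2.1. [folklore] -/
theorem localOp_chainBlock_spinDot (L : ℕ) (x : Fin L) (h : (x : ℕ) + 2 ≤ L) :
    localOp (chainBlock L 2 x h) ((spinDot 2 (0 : Fin 2) 1).submatrix
        (fun σ i => σ (chainBlockSite L 2 x h i)) (fun σ i => σ (chainBlockSite L 2 x h i))) =
      spinDot 2 x (⟨x + 1, by omega⟩ : Fin L) := by
  have hg := chainBlockSite_bijective L 2 x h
  have h0 : ((chainBlockSite L 2 x h 0 : chainBlock L 2 x h) : Fin L) = x := Fin.ext (by simp)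
  have h1 : ((chainBlockSite L 2 x h 1 : chainBlock L 2 x h) : Fin L) = ⟨x + 1, by omega⟩ :=
    Fin.ext (by simp)
  simp only [spinDot, spinBond, siteSpin, localOp_submatrix_sum, localOp_submatrix_smul,
    localOp_submatrix_add, localOp_submatrix_mul _ hg, localOp_submatrix_onSite _ hg, h0, h1]

/-- **The block term of the open AKLT parent Hamiltonian is `P₂(x, x+1)`.** Placing the two-site
parent term `h = 1 - P_{𝒢₂} = P₂ = ⅙ (𝐒₀·𝐒₁)² + ½ 𝐒₀·𝐒₁ + ⅓` of the AKLT tensor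
(`parentLocalTerm_two_akltTensor`) on the block `{x, x+1}` of `Fin L` gives
`⅙ (𝐒_x·𝐒_{x+1})² + ½ 𝐒_x·𝐒_{x+1} + ⅓`. AKLT (1988) §2.1, eq. (2.1); Fannes–Nachtergaele–Werner
(1992), eq. (1.1). [cite: AffleckEtAl1988, §2.1 eq. (2.1)] -/
theorem localOp_chainBlock_parentLocalTerm_akltTensor (L : ℕ) (x : Fin L) (h : (x : ℕ) + 2 ≤ L) :
    localOp (chainBlock L 2 x h) ((parentLocalTerm 2 akltTensor).submatrix
        (fun σ i => σ (chainBlockSite L 2 x h i)) (fun σ i => σ (chainBlockSite L 2 x h i))) =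
      (1 / 6 : ℂ) • (spinDot 2 x (⟨x + 1, by omega⟩ : Fin L) *
          spinDot 2 x (⟨x + 1, by omega⟩ : Fin L)) +
        (1 / 2 : ℂ) • spinDot 2 x (⟨x + 1, by omega⟩ : Fin L) + (1 / 3 : ℂ) • (1 : Op (Fin L) 3) := by
  have hg := chainBlockSite_bijective L 2 x h
  have hD := localOp_chainBlock_spinDot L x h
  rw [parentLocalTerm_two_akltTensor]
  simp only [localOp_submatrix_add, localOp_submatrix_smul, localOp_submatrix_mul _ hg,
    localOp_submatrix_one _ hg, hD]

/-! ### The AKLT chain is twice the open parent Hamiltonian, shifted -/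

/-- The open chain on `L ≥ 1` sites has `L - 1` bonds `{x, x+1}`, `x + 2 ≤ L`. [folklore] -/
theorem card_filter_add_two_le (L : ℕ) (hL : 1 ≤ L) :
    (Finset.univ.filter fun x : Fin L => (x : ℕ) + 2 ≤ L).card = L - 1 := by
  obtain ⟨n, rfl⟩ : ∃ n, L = n + 1 := ⟨L - 1, by omega⟩
  have h : (Finset.univ.filter fun x : Fin (n + 1) => (x : ℕ) + 2 ≤ n + 1) =
      Finset.univ.filter fun x : Fin (n + 1) => x ≠ Fin.last n := by
    ext x
    simp only [Finset.mem_filter, Finset.mem_univ, true_and, ne_eq, Fin.ext_iff, Fin.val_last]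
    omega
  rw [h, Finset.filter_ne', Finset.card_erase_of_mem (Finset.mem_univ _), Finset.card_univ,
    Fintype.card_fin, Nat.add_sub_cancel]

/-- **`H_AKLT = 2 H_parent - 2(L-1)/3` on the open chain** (`1 ≤ L`). The open AKLT chain
`Σ_{i+1=j} (𝐒_i · 𝐒_j + ⅓ (𝐒_i · 𝐒_j)²)` equals `2 Σ_{x+2 ≤ L} P₂(x, x+1) - (2(L-1)/3) 𝟙`, where
`Σ_x P₂(x, x+1) = parentHamiltonianOpen L 2 akltTensor`: each bond term is
`h_{x,x+1} = 2 P₂(x,x+1) - ⅔` (`localOp_chainBlock_parentLocalTerm_akltTensor`) and there are `L - 1`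
bonds (`card_filter_add_two_le`). AKLT (1988) §2.1, eqs. (2.1)–(2.2) (`H = Σ_i P₂(𝐒_i + 𝐒_{i+1})`
with `P₂ = ½ 𝐒_i·𝐒_{i+1} + ⅙ (𝐒_i·𝐒_{i+1})² + ⅓`); Tasaki (2020) §7.1, eq. (7.1.1).
[cite: AffleckEtAl1988, §2.1 eqs. (2.1)–(2.2)] -/
theorem akltOpenChain_eq_parentHamiltonianOpen (L : ℕ) (hL : 1 ≤ L) :
    akltOpenChain L = (2 : ℂ) • parentHamiltonianOpen L 2 akltTensor +
      (-(2 * ((L : ℂ) - 1) / 3)) • (1 : Op (Fin L) 3) := by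
  -- the constrained double sum is a sum over left endpoints
  have hinner : ∀ i : Fin L, (∑ j : Fin L, if i.val + 1 = j.val then akltBond i j else 0) =
      if h : (i : ℕ) + 2 ≤ L then akltBond i (⟨i + 1, by omega⟩ : Fin L) else 0 := by
    intro i
    by_cases h : (i : ℕ) + 2 ≤ L
    · rw [dif_pos h, Finset.sum_eq_single (⟨i + 1, by omega⟩ : Fin L)]
      · simp
      · intro j _ hj
        rw [if_neg]
        intro hij
        exact hj (Fin.ext (by simp; omega))
      · exact fun hi => absurd (Finset.mem_univ _) hi
    · rw [dif_neg h]
      refine Finset.sum_eq_zero fun j _ => ?_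
      rw [if_neg]
      have := j.isLt
      omega
  -- each bond term is `2 P₂ - 2/3`
  have hbond : ∀ (i : Fin L) (h : (i : ℕ) + 2 ≤ L), akltBond i (⟨i + 1, by omega⟩ : Fin L) =
      (2 : ℂ) • localOp (chainBlock L 2 i h) ((parentLocalTerm 2 akltTensor).submatrix
        (fun σ k => σ (chainBlockSite L 2 i h k)) (fun σ k => σ (chainBlockSite L 2 i h k))) +
        (-(2 / 3 : ℂ)) • (1 : Op (Fin L) 3) := by
    intro i h
    rw [localOp_chainBlock_parentLocalTerm_akltTensor, akltBond]
    module
  unfold akltOpenChain parentHamiltonianOpen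
  simp_rw [hinner]
  rw [Finset.smul_sum]
  have hsplit : ∀ i : Fin L, (if h : (i : ℕ) + 2 ≤ L then akltBond i (⟨i + 1, by omega⟩ : Fin L)
      else 0) = (2 : ℂ) • (if h : (i : ℕ) + 2 ≤ L then localOp (chainBlock L 2 i h)
        ((parentLocalTerm 2 akltTensor).submatrix (fun σ k => σ (chainBlockSite L 2 i h k))
          (fun σ k => σ (chainBlockSite L 2 i h k))) else 0) +
      (if (i : ℕ) + 2 ≤ L then (-(2 / 3 : ℂ)) • (1 : Op (Fin L) 3) else 0) := by
    intro i
    by_cases h : (i : ℕ) + 2 ≤ L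
    · rw [dif_pos h, dif_pos h, if_pos h, hbond i h]
    · rw [dif_neg h, dif_neg h, if_neg h, smul_zero, add_zero]
  simp_rw [hsplit]
  rw [Finset.sum_add_distrib, Finset.sum_ite, Finset.sum_const_zero, add_zero, Finset.sum_const,
    card_filter_add_two_le L hL, ← Nat.cast_smul_eq_nsmul ℂ, smul_smul]
  congr 1
  rw [Nat.cast_sub hL]
  push_cast
  ring_nf

/-! ### The open parent Hamiltonian of the AKLT tensor: positivity and kernel -/

/-- The parent Hamiltonian with open boundary conditions is positive semidefinite: each block term
is the positive local term `h = 1 - P_{𝒢_ℓ}` (`parentLocalTerm_posSemidef`), reindexed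
(`Matrix.PosSemidef.submatrix`) and tensored with the identity (`posSemidef_localOp`).
Fannes–Nachtergaele–Werner (1992) §5, Def. 5.4 and eq. (5.11).
[cite: FannesNachtergaeleWernerCMP1992, §5 Def. 5.4 and eq. (5.11)] -/
theorem parentHamiltonianOpen_posSemidef {q D : ℕ} (L ℓ : ℕ) (A : MPSTensor q D) :
    (parentHamiltonianOpen L ℓ A).PosSemidef := by
  unfold parentHamiltonianOpen
  refine posSemidef_sum _ fun x _ => ?_
  split_ifs with h
  · exact posSemidef_localOp _ ((parentLocalTerm_posSemidef ℓ A).submatrix _)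
  · exact PosSemidef.zero

/-- Gluing twice into the same block keeps the last glued word (injective site map). [folklore] -/
theorem extend_extend_of_injective {α β γ : Type*} {g : α → β} (hg : Function.Injective g)
    (w w' : α → γ) (σ : β → γ) :
    Function.extend g w (Function.extend g w' σ) = Function.extend g w σ := by
  funext y
  by_cases hy : ∃ i, g i = y
  · obtain ⟨i, rfl⟩ := hy
    rw [hg.extend_apply, hg.extend_apply]
  · rw [Function.extend_apply' _ _ _ hy, Function.extend_apply' _ _ _ hy,
      Function.extend_apply' _ _ _ hy]

/-- **A block term kills `ψ` iff its local term kills every block slice of `ψ`.** For an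
`ℓ`-site operator `N` placed on the block `{x, …, x+ℓ-1}` of the open chain,
`N_{x,…} ψ = 0 ↔ ∀ σ, N (w ↦ ψ(σ[x,…,x+ℓ-1 := w])) = 0`
(`localOp_chainBlock_submatrix_mulVec_apply`; for `⇒` evaluate at the glued configurations
`σ[… := w']`). Bratteli–Robinson II §6.2.1 (`𝔄_X ∋ A ↦ A ⊗ 𝟙` acts on the factor `𝓗_X`).
[folklore] -/
theorem localOp_chainBlock_submatrix_mulVec_eq_zero_iff {q L ℓ : ℕ} (x : Fin L)
    (h : (x : ℕ) + ℓ ≤ L) (N : Op (Fin ℓ) q) (ψ : TensorIndex (Fin L) q → ℂ) :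
    localOp (chainBlock L ℓ x h) (N.submatrix (fun σ i => σ (chainBlockSite L ℓ x h i))
        (fun σ i => σ (chainBlockSite L ℓ x h i))) *ᵥ ψ = 0 ↔
      ∀ σ : TensorIndex (Fin L) q,
        N *ᵥ (fun w => ψ (Function.extend (fun i : Fin ℓ => (⟨x + i, by omega⟩ : Fin L)) w σ))
          = 0 := by
  constructor
  · intro hz σ
    funext w'
    have hw := congr_fun hz (Function.extend (fun i : Fin ℓ => (⟨x + i, by omega⟩ : Fin L)) w' σ)
    rw [localOp_chainBlock_submatrix_mulVec_apply, Pi.zero_apply] at hw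
    simp only [extend_extend_of_injective (blockSite_injective x h),
      (blockSite_injective x h).extend_apply] at hw
    exact hw
  · intro hσ
    funext σ
    rw [localOp_chainBlock_submatrix_mulVec_apply, hσ σ]
    rfl

/-- **Kernel of the open AKLT parent Hamiltonian** (`2 ≤ L`): `Σ_x P₂(x, x+1) ψ = 0` iff `ψ` is a
valence-bond-solid state with free boundary spins, `ψ = ψ_B = mpsWithBoundary L akltTensor B`.
`⇐`: `parentHamiltonianOpen_mulVec_mpsWithBoundary_eq_zero_holds` (AKLT (1988) §2.1,
"`H_i Ω^{αβ} = 0`"); `⇒`: the positive block terms vanish separately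
(`mulVec_eq_zero_of_sum_posSemidef`), i.e. every two-site slice is killed by `P₂`
(`localOp_chainBlock_submatrix_mulVec_eq_zero_iff`), and AKLT's finite-volume Lemma 2.8
(`exists_mpsWithBoundary_akltTensor_of_parentLocalTerm_mulVec_eq_zero`) applies.
[cite: AffleckEtAl1988, §2.4 Lemma 2.8] -/
theorem parentHamiltonianOpen_akltTensor_mulVec_eq_zero_iff (L : ℕ) (hL : 2 ≤ L)
    (ψ : TensorIndex (Fin L) 3 → ℂ) :
    parentHamiltonianOpen L 2 akltTensor *ᵥ ψ = 0 ↔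
      ∃ B : Matrix (Fin 2) (Fin 2) ℂ, ψ = mpsWithBoundary L akltTensor B := by
  constructor
  · intro hz
    refine exists_mpsWithBoundary_akltTensor_of_parentLocalTerm_mulVec_eq_zero L hL ψ
      fun x hx σ => ?_
    have hx' : ((⟨x, by omega⟩ : Fin L) : ℕ) + 2 ≤ L := hx
    have hterm := mulVec_eq_zero_of_sum_posSemidef (s := Finset.univ)
      (fun (y : Fin L) _ => show Matrix.PosSemidef
        (if h : (y : ℕ) + 2 ≤ L then localOp (chainBlock L 2 y h)
          ((parentLocalTerm 2 akltTensor).submatrix (fun σ i => σ (chainBlockSite L 2 y h i))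
            (fun σ i => σ (chainBlockSite L 2 y h i))) else 0) from by
        split_ifs with h
        · exact posSemidef_localOp _ ((parentLocalTerm_posSemidef 2 akltTensor).submatrix _)
        · exact PosSemidef.zero) hz ⟨x, by omega⟩ (Finset.mem_univ _)
    rw [dif_pos hx'] at hterm
    exact (localOp_chainBlock_submatrix_mulVec_eq_zero_iff _ hx' _ ψ).1 hterm σ
  · rintro ⟨B, rfl⟩
    exact parentHamiltonianOpen_mulVec_mpsWithBoundary_eq_zero_holds L 2 akltTensor B

/-! ### Discharge of `aklt_open_degeneracy` -/

/-- The open AKLT chain is Hermitian (a sum of Hermitian bond terms). AKLT (1988) §2.1. [folklore] -/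
theorem akltOpenChain_isHermitian (L : ℕ) : (akltOpenChain L).IsHermitian := by
  unfold akltOpenChain
  rw [IsHermitian, conjTranspose_sum]
  refine Finset.sum_congr rfl fun i _ => ?_
  rw [conjTranspose_sum]
  refine Finset.sum_congr rfl fun j _ => ?_
  split_ifs
  · exact (akltBond_isHermitian i j).eq
  · exact conjTranspose_zero

/-- **Discharge of `aklt_open_degeneracy` (AKLT: the open chain has an exactly fourfold
degenerate ground state of energy `-2(L-1)/3`).** For `2 ≤ L`: `H = 2Q - (2(L-1)/3) 𝟙` with
`Q = Σ_x P₂(x, x+1) ≥ 0` (`akltOpenChain_eq_parentHamiltonianOpen`,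
`parentHamiltonianOpen_posSemidef`); `ker Q = {ψ_B : B ∈ M₂(ℂ)}`
(`parentHamiltonianOpen_akltTensor_mulVec_eq_zero_iff`, AKLT's Lemma 2.8) and `B ↦ ψ_B` is
injective (`eq_of_trace_mul_wordProduct_eq`, `isInjectiveMPS_akltTensor_two`: "the four ground
states are nonzero and linearly independent"); hence `ψ_𝟙 ≠ 0` is an eigenvector of energy
`-2(L-1)/3` above which `H + 2(L-1)/3 = 2Q ≥ 0`, so `E₀ = -2(L-1)/3`
(`groundEnergy_eq_of_posSemidef_sub`), and the ground space `ker (H - E₀) = ker Q` is the range of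
the injective linear map `B ↦ ψ_B` on `M₂(ℂ)`, of dimension `4`. AKLT, CMP 115 (1988), §2.1
Remark 1 (p. 484: "Hence the open chain has a fourfold degenerate ground state") and §2.4 Lemma 2.8;
Tasaki (2020) §7.1.2. [cite: AffleckEtAl1988, §2.1 Remark 1 (p. 484) and §2.4 Lemma 2.8] -/
theorem aklt_open_degeneracy_holds : aklt_open_degeneracy := by
  intro L hL
  have hL1 : 1 ≤ L := by omega
  set Q := parentHamiltonianOpen L 2 akltTensor with hQ
  set E : ℝ := -(2 * ((L : ℝ) - 1) / 3) with hE
  have hEC : ((E : ℝ) : ℂ) = -(2 * ((L : ℂ) - 1) / 3) := by rw [hE]; push_cast; ring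
  have hH : akltOpenChain L = (2 : ℂ) • Q + algebraMap ℝ (Op (Fin L) 3) E := by
    rw [Algebra.algebraMap_eq_smul_one, ← Complex.coe_smul, hEC]
    exact akltOpenChain_eq_parentHamiltonianOpen L hL1
  have hQpsd : Q.PosSemidef := parentHamiltonianOpen_posSemidef L 2 akltTensor
  have hdiff : (akltOpenChain L - algebraMap ℝ (Op (Fin L) 3) E).PosSemidef := by
    rw [hH, add_sub_cancel_right, two_smul]
    exact hQpsd.add hQpsd
  -- `B ↦ ψ_B` is injective on `L ≥ 2` sites
  have hinj : Function.Injective (mpsWithBoundary L akltTensor) := fun B₁ B₂ h =>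
    eq_of_trace_mul_wordProduct_eq (isInjectiveMPS_akltTensor_two.of_le two_pos hL)
      fun w => congr_fun h w
  have hzero : mpsWithBoundary L akltTensor 0 = 0 := by
    funext σ; simp [mpsWithBoundary]
  have hψ1 : mpsWithBoundary L akltTensor 1 ≠ 0 := fun h =>
    one_ne_zero (hinj (h.trans hzero.symm))
  have hker := parentHamiltonianOpen_akltTensor_mulVec_eq_zero_iff L hL
  -- the eigenvalue equation at `E` is `Q ψ = 0`
  have heig : ∀ ψ : TensorIndex (Fin L) 3 → ℂ,
      akltOpenChain L *ᵥ ψ = (E : ℂ) • ψ ↔ Q *ᵥ ψ = 0 := by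
    intro ψ
    rw [hH, add_mulVec, smul_mulVec, Algebra.algebraMap_eq_smul_one, smul_mulVec, one_mulVec,
      ← Complex.coe_smul, add_eq_right, smul_eq_zero_iff_right two_ne_zero]
  have hGE : (akltOpenChain L).groundEnergy = E :=
    groundEnergy_eq_of_posSemidef_sub (akltOpenChain_isHermitian L) E hdiff hψ1
      ((heig _).2 ((hker _).2 ⟨1, rfl⟩))
  refine ⟨?_, hGE⟩
  -- the ground space is the range of the linear map `B ↦ ψ_B`
  let Φ : Matrix (Fin 2) (Fin 2) ℂ →ₗ[ℂ] (TensorIndex (Fin L) 3 → ℂ) :=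
    LinearMap.pi fun σ => Matrix.traceLinearMap (Fin 2) ℂ ℂ ∘ₗ
      LinearMap.mulRight ℂ (wordProduct akltTensor σ)
  have hΦ : ∀ B, Φ B = mpsWithBoundary L akltTensor B := fun B => rfl
  have hΦinj : Function.Injective Φ := fun B₁ B₂ h => hinj (by rw [← hΦ, ← hΦ, h])
  have hGS : (akltOpenChain L).groundSpace = LinearMap.range Φ := by
    ext ψ
    rw [mem_groundSpace_iff, hGE, heig, hker, LinearMap.mem_range]
    constructor
    · rintro ⟨B, rfl⟩; exact ⟨B, hΦ B⟩
    · rintro ⟨B, rfl⟩; exact ⟨B, (hΦ B).symm⟩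
  rw [groundStateDegeneracy, hGS, LinearMap.finrank_range_of_inj hΦinj, Module.finrank_matrix,
    Fintype.card_fin, Module.finrank_self]

end QLattice

end Literature.MathematicalPhysics.QuantumLattice
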